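import Mathlib
import Literature.Analysis.FluidPDE.HardSphereCollisionRecord
import Literature.MathematicalPhysics.KineticTheory.HardSphereEuler
import Literature.MathematicalPhysics.KineticTheory.HardSphereEulerProofs
import Summits.AtomisticToContinuum.HydrodynamicLimit.Theorems.OneFlightGossipEngineOneFlightLayeredChaosFluxRegimes
import Summits.AtomisticToContinuum.HydrodynamicLimit.Theorems.OneFlightGossipEngineOneFlightLayeredChaosFirstCollision
import Summits.AtomisticToContinuum.HydrodynamicLimit.Theorems.OneFlightGossipEngineOneFlightLayeredChaosFluxFunctional
import HarnessLib

/-!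
# `OneFlightGossipEngine.OneFlightLayeredChaos` — the time-zero entrance form of the first rung and its reduction
(crux stmt-AtomisticToContinuum-14535, line `Sketch`, serves the stub `stub_firstFlight_flux` — the `n = 0`, fresh-partner
rung — through the registered stub `regimeFluxBody_firstFlight_of_input`; stub worker of lead cycle c3, 2026-08-16). Part of the Lean-checked reduction
`FirstFlightVelInput θ₀ → FirstFlightPairInput θ₀ → FirstFlightInput θ₀ → RegimeFluxBody θ₀ ((shortGap θ₀ 0).inter nZero)`
split over the files `…FirstCollision`, `…FluxFunctional`, `…PairMeasurable`, `…FirstFlightInput`,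
`…FirstFlightPairInput`, `…FirstFlightVelInput` (grouping namespace `OLC`).

`FirstFlightInput θ₀` (typed hypothesis of the line, an `Objects`-style `def … : Prop`): conditionally on the `ℓ`-cells
and exact velocities of everybody AT TIME `0` and on the first partner `j`, on the first-flight event, the free-flight
contact normal is flux-distributed up to `Cσ^p`. `regimeFluxBody_firstFlight_of_input`: it implies the flux-form body
of the crux on the regime `{s_i = s_j} ∩ {n = 0}` (the skeleton's `(shortGap θ₀ 0).inter nZero`, `nZero` inlined as
`fun _ n _ _ _ => {_z | n = 0}`).
-/

open scoped BigOperators ENNReal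
open MeasureTheory Set
open Literature.Analysis.FluidPDE Literature.MathematicalPhysics.KineticTheory
open Summit.AtomisticToContinuum.HydrodynamicLimit.Theorems

namespace Summit.AtomisticToContinuum.HydrodynamicLimit.Theorems.OLC

noncomputable section

/-! ## The typed input -/

/-- **First-flight input (time-zero entrance form of the first rung).** For `N ≥ N₀(σ, τ)`, every flow `Φ`, tagged
particle `i`, measurable `S ⊆ ℝ³ × ℝ³` and measurable `T ⊆ (cells × velocities)^{N+1} × Fin (N+1)`:
with `t₀ z` the first collision time of `i` after `0`, `j z` its partner there,
`F = Φ.good ∩ {t₀ ∈ (0, w] ∧ j has no collision in (0, t₀)}` (the first flight of `i` ends inside the window on a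
FRESH partner: both free paths from time `0` reach the contact unobstructed), `ĝ₀ z = (v_i − v_j)/‖v_i − v_j‖` and
`ω₀ z = ε⁻¹ sepVec (x_i + t₀ v_i) (x_j + t₀ v_j)` (contact normal of the two free flights, all read at time `0`),
`D = {(coarseConfig q z, j z) ∈ T}`:
`|P(F ∩ {(ĝ₀, ω₀) ∈ S} ∩ D) − ∫_{F ∩ D} Flux_{ĝ₀ z}(S_{ĝ₀ z}) dP| ≤ C σ^p`,
`P` the global Gibbs law at activity `1`, temperature `θ₀`, mesh `ρ⋆(σ)`. A typed HYPOTHESIS of the line (a named `Prop` the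
route posits; nothing is asserted, it is not a published fact); reduction: `regimeFluxBody_firstFlight_of_input`. -/
def FirstFlightInput (θ₀ : ℝ) : Prop :=
  ∃ C : ℝ, 0 < C ∧ ∃ p : ℝ, 0 < p ∧ ∃ σ₀ : ℝ, 0 < σ₀ ∧ ∀ σ : ℝ, 0 < σ → σ < σ₀ →
  ∀ τ : ℝ, 0 < τ → ∃ N₀ : ℕ, ∀ N : ℕ, N₀ ≤ N →
    ∀ Φ : HardSphereFlow (Torus.geometry (Fin 3)) (hsDiameter σ N) (N + 1),
    ∀ (i : Fin (N + 1)) (S : Set (V3 × V3)), MeasurableSet S →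
    ∀ T : Set ((Fin (N + 1) → (Fin 3 → ℤ) × V3) × Fin (N + 1)), MeasurableSet T →
    let G : Geometry (Fin 3) T3 := Torus.geometry (Fin 3)
    let ε : ℝ := hsDiameter σ N
    let w : ℝ := τ * ((N + 1 : ℕ) : ℝ) ^ (-(1 / 3 : ℝ))
    let q : T3 → (Fin 3 → ℤ) := Torus.coarseCell (rhoStar σ * ((N + 1 : ℕ) : ℝ) ^ (-(1 / 3 : ℝ)))
    let P : Measure (Config (N + 1) (Fin 3) T3) := localGibbsLaw σ (fun _ => 1) (fun _ => 0) (fun _ => θ₀) N Φ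
    let t₀ : Config (N + 1) (Fin 3) T3 → ℝ := fun z => Φ.nthCollisionTimeOf i 0 z
    let j : Config (N + 1) (Fin 3) T3 → Fin (N + 1) := fun z => Φ.nthPartnerOf i 0 z
    let F : Set (Config (N + 1) (Fin 3) T3) := Φ.good ∩ {z | t₀ z ∈ Set.Ioc 0 w ∧
        ∀ u ∈ Set.Ioo 0 (t₀ z), ¬ Participates G ε (Φ.flow u z) (j z)}
    let gZero : Config (N + 1) (Fin 3) T3 → V3 := fun z =>
      ‖(z i).2 - (z (j z)).2‖⁻¹ • ((z i).2 - (z (j z)).2)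
    let ωZero : Config (N + 1) (Fin 3) T3 → V3 := fun z =>
      ε⁻¹ • G.sepVec (G.translate (z i).1 (t₀ z • (z i).2)) (G.translate (z (j z)).1 (t₀ z • (z (j z)).2))
    let flux : V3 → Set V3 → ℝ := fun g U =>
      ((∫⁻ ω, U.indicator (fun _ => (1 : ℝ≥0∞)) (ω : V3) * ENNReal.ofReal (max (-inner ℝ (ω : V3) g) 0)
          ∂(sphereMeasure (E := V3))) /
        (∫⁻ ω, ENNReal.ofReal (max (-inner ℝ (ω : V3) g) 0) ∂(sphereMeasure (E := V3)))).toReal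
    let D : Set (Config (N + 1) (Fin 3) T3) := {z | (coarseConfig q z, j z) ∈ T}
    |(P (F ∩ {z | (gZero z, ωZero z) ∈ S} ∩ D)).toReal -
        ∫ z in F ∩ D, flux (gZero z) {ω | (gZero z, ω) ∈ S} ∂P| ≤ C * σ ^ p

/-! ## The reduction: `FirstFlightInput θ₀ → RegimeFluxBody θ₀ ((shortGap θ₀ 0).inter nZero)` -/

/-- **The reduction of the first rung to its time-zero entrance form.** `FirstFlightInput θ₀` implies the flux-form
body of the crux on the regime `{s_i = s_j} ∩ {n = 0}` (the lead's `(shortGap θ₀ 0).inter nZero`, with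
`nZero := fun _ n _ _ _ => {_z | n = 0}` inlined). For `n ≥ 1` the regime is empty. For `n = 0`: a `𝒢`-event is
the preimage of a measurable `T` under `z ↦ (coarsePastOf q i 0 z, nthPartnerOf i 0 z)`; on `Φ.good` the event
`W ∩ X` is the first-flight event `F` (`window_sameStart_iff_firstFlight`), on which both snapshots of the coarse
past are the time-`0` configuration (`coarsePastOf_eq_of_firstFlight`: so `E` pulls back to
`D = {(coarseConfig q z, j z) ∈ T'}` with `T'` the diagonal preimage of `T`, and `gIn = ĝ₀`), and the recorded
impact vector is the free-flight contact normal `ω₀` (`impactVec_eq_of_firstFlight`); the crux's two terms and the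
input's two terms then agree because `P(goodᶜ) = 0` (`localGibbsLaw_one_compl_good`). [folklore] -/
theorem regimeFluxBody_firstFlight_of_input : ∀ {θ₀ : ℝ}, Summit.AtomisticToContinuum.HydrodynamicLimit.Theorems.OLC.FirstFlightInput θ₀ → Summit.AtomisticToContinuum.HydrodynamicLimit.Theorems.OLC.RegimeFluxBody θ₀ ((Summit.AtomisticToContinuum.HydrodynamicLimit.Theorems.OLC.shortGap θ₀ 0).inter (fun _ n _ _ _ => {_z | n = 0})) := by
  intro θ₀ h
  obtain ⟨C, hC, p, hp, σ₀, hσ₀, H⟩ := h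
  refine ⟨C, hC, p, hp, σ₀, hσ₀, fun σ hσ hσ0 => ?_⟩
  intro τ hτ n
  rcases Nat.eq_zero_or_pos n with rfl | hn
  · -- `n = 0`: the first rung
    obtain ⟨N₀, hN₀⟩ := H σ hσ hσ0 τ hτ
    refine ⟨N₀, fun N hN Φ i S hS => ?_⟩
    intro G ε w q P W gIn flux E hE
    -- the `𝒢`-event as a preimage, pulled back along the diagonal
    obtain ⟨T, hT, rfl⟩ := MeasurableSpace.measurableSet_comap.1 hE
    set T' : Set ((Fin (N + 1) → (Fin 3 → ℤ) × V3) × Fin (N + 1)) := {p | ((p.1, p.1), p.2) ∈ T} with hT'def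
    have hT' : MeasurableSet T' := measurableSet_diag_preimage hT
    have hmain := hN₀ N hN Φ i S hS T' hT'
    -- the objects of the input
    set t₀ : Config (N + 1) (Fin 3) T3 → ℝ := fun z => Φ.nthCollisionTimeOf i 0 z with ht₀def
    set jp : Config (N + 1) (Fin 3) T3 → Fin (N + 1) := fun z => Φ.nthPartnerOf i 0 z with hjpdef
    set F : Set (Config (N + 1) (Fin 3) T3) := Φ.good ∩ {z | t₀ z ∈ Set.Ioc 0 w ∧
        ∀ u ∈ Set.Ioo 0 (t₀ z), ¬ Participates G ε (Φ.flow u z) (jp z)} with hFdef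
    set gZero : Config (N + 1) (Fin 3) T3 → V3 := fun z =>
      ‖(z i).2 - (z (jp z)).2‖⁻¹ • ((z i).2 - (z (jp z)).2) with hgZerodef
    set ωZero : Config (N + 1) (Fin 3) T3 → V3 := fun z =>
      ε⁻¹ • G.sepVec (G.translate (z i).1 (t₀ z • (z i).2)) (G.translate (z (jp z)).1 (t₀ z • (z (jp z)).2))
      with hωZerodef
    set D : Set (Config (N + 1) (Fin 3) T3) := {z | (coarseConfig q z, jp z) ∈ T'} with hDdef
    have hmain' : |(P (F ∩ {z | (gZero z, ωZero z) ∈ S} ∩ D)).toReal -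
        ∫ z in F ∩ D, flux (gZero z) {ω | (gZero z, ω) ∈ S} ∂P| ≤ C * σ ^ p := hmain
    -- the regime at `n = 0` and the generating map of `𝒢`
    set X : Set (Config (N + 1) (Fin 3) T3) :=
      ((shortGap θ₀ 0).inter fun _ n _ _ _ => {_z | n = 0}) σ 0 N Φ i with hXdef
    set f : Config (N + 1) (Fin 3) T3 →
        ((Fin (N + 1) → (Fin 3 → ℤ) × V3) × (Fin (N + 1) → (Fin 3 → ℤ) × V3)) × Fin (N + 1) :=
      fun z => (Φ.coarsePastOf q i 0 z, Φ.nthPartnerOf i 0 z) with hfdef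
    -- (1) on the good set, `W ∩ X` is the first-flight event `F`
    have hF_iff : ∀ z ∈ Φ.good, (z ∈ W ∧ z ∈ X) ↔ z ∈ F := by
      intro z hz
      have key := window_sameStart_iff_firstFlight Φ i hz w (0 * mfTime σ θ₀ N) (zero_mul _)
      constructor
      · rintro ⟨hW, hX⟩
        have hX' : |flightStart (Torus.geometry (Fin 3)) (hsDiameter σ N) (fun t => Φ.flow t z) 0 i
              (Φ.nthCollisionTimeOf i 0 z) -
            flightStart (Torus.geometry (Fin 3)) (hsDiameter σ N) (fun t => Φ.flow t z) 0 (Φ.nthPartnerOf i 0 z)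
              (Φ.nthCollisionTimeOf i 0 z)| ≤ 0 * mfTime σ θ₀ N := hX.1
        exact ⟨hz, key.1 ⟨hW, hX'⟩⟩
      · rintro ⟨-, hF⟩
        obtain ⟨hW', hX'⟩ := key.2 hF
        exact ⟨hW', hX', rfl⟩
    -- (2) on `F` both snapshots of the coarse past are the time-`0` configuration
    have hpast : ∀ z ∈ F, Φ.coarsePastOf q i 0 z = (coarseConfig q z, coarseConfig q z) :=
      fun z hz => coarsePastOf_eq_of_firstFlight Φ i q hz.1 hz.2.1.1 hz.2.2
    -- (3) on `F` the `𝒢`-measurable incoming direction is `ĝ₀`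
    have hgIn_def : gIn = fun z =>
        ‖((Φ.coarsePastOf q i 0 z).1 i).2 - ((Φ.coarsePastOf q i 0 z).2 (Φ.nthPartnerOf i 0 z)).2‖⁻¹ •
          (((Φ.coarsePastOf q i 0 z).1 i).2 - ((Φ.coarsePastOf q i 0 z).2 (Φ.nthPartnerOf i 0 z)).2) := rfl
    have hgIn : ∀ z ∈ F, gIn z = gZero z := by
      intro z hz
      rw [hgIn_def]
      simp only [hpast z hz]
      rfl
    -- (4) on `F` the recorded impact vector is the free-flight contact normal `ω₀`
    have himp : ∀ z ∈ F, (Φ.nthRecordOf i 0 z).impactVec = ωZero z :=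
      fun z hz => impactVec_eq_of_firstFlight Φ i hz.1 hz.2.1.1 hz.2.2
    -- (5) on `F` the `𝒢`-event pulls back to `D`
    have hE_iff : ∀ z ∈ F, z ∈ f ⁻¹' T ↔ z ∈ D := by
      intro z hz
      simp only [hfdef, hDdef, hT'def, mem_preimage, mem_setOf_eq, hpast z hz]
      exact Iff.rfl
    -- (6) the set identities up to the good set
    have hset1 : (W ∩ {z | (gIn z, (Φ.nthRecordOf i 0 z).impactVec) ∈ S} ∩ (X ∩ f ⁻¹' T)) ∩ Φ.good =
        F ∩ {z | (gZero z, ωZero z) ∈ S} ∩ D := by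
      ext z
      constructor
      · rintro ⟨⟨⟨hW, hA⟩, hX, hET⟩, hz⟩
        have hzF : z ∈ F := (hF_iff z hz).1 ⟨hW, hX⟩
        refine ⟨⟨hzF, ?_⟩, (hE_iff z hzF).1 hET⟩
        simp only [mem_setOf_eq] at hA ⊢
        rwa [hgIn z hzF, himp z hzF] at hA
      · rintro ⟨⟨hzF, hA⟩, hD⟩
        have hz : z ∈ Φ.good := hzF.1
        obtain ⟨hW, hX⟩ := (hF_iff z hz).2 hzF
        refine ⟨⟨⟨hW, ?_⟩, hX, (hE_iff z hzF).2 hD⟩, hz⟩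
        simp only [mem_setOf_eq] at hA ⊢
        rwa [hgIn z hzF, himp z hzF]
    have hset2 : (W ∩ (X ∩ f ⁻¹' T)) ∩ Φ.good = F ∩ D := by
      ext z
      constructor
      · rintro ⟨⟨hW, hX, hET⟩, hz⟩
        have hzF : z ∈ F := (hF_iff z hz).1 ⟨hW, hX⟩
        exact ⟨hzF, (hE_iff z hzF).1 hET⟩
      · rintro ⟨hzF, hD⟩
        have hz : z ∈ Φ.good := hzF.1
        obtain ⟨hW, hX⟩ := (hF_iff z hz).2 hzF
        exact ⟨⟨hW, hX, (hE_iff z hzF).2 hD⟩, hz⟩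
    -- (7) `F` is measurable
    have hFmeas : MeasurableSet F := measurableSet_firstFlightEvent Φ i w
    -- (8) `P(goodᶜ) = 0`: the two pairs of terms agree
    have hnull : P Φ.goodᶜ = 0 := localGibbsLaw_one_compl_good σ θ₀ N Φ
    have hgood : Φ.good =ᵐ[P] (univ : Set (Config (N + 1) (Fin 3) T3)) := ae_eq_univ.2 hnull
    have h1 : P (W ∩ {z | (gIn z, (Φ.nthRecordOf i 0 z).impactVec) ∈ S} ∩ (X ∩ f ⁻¹' T)) =
        P (F ∩ {z | (gZero z, ωZero z) ∈ S} ∩ D) := by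
      rw [← hset1, measure_inter_conull hnull]
    have h2 : ∫ z in W ∩ (X ∩ f ⁻¹' T), flux (gIn z) {ω | (gIn z, ω) ∈ S} ∂P =
        ∫ z in F ∩ D, flux (gIn z) {ω | (gIn z, ω) ∈ S} ∂P := by
      refine setIntegral_congr_set ?_
      rw [← hset2]
      exact (inter_ae_eq_left_of_ae_eq_univ hgood).symm
    have hae : ∀ᵐ z ∂(P.restrict (F ∩ D)), z ∈ F := by
      rw [ae_iff]
      refine measure_mono_null (t := Fᶜ) (fun z hz => hz) ?_
      rw [Measure.restrict_apply hFmeas.compl]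
      exact measure_mono_null (t := (∅ : Set (Config (N + 1) (Fin 3) T3))) (fun z hz => hz.1 hz.2.1)
        measure_empty
    have h3 : ∫ z in F ∩ D, flux (gIn z) {ω | (gIn z, ω) ∈ S} ∂P =
        ∫ z in F ∩ D, flux (gZero z) {ω | (gZero z, ω) ∈ S} ∂P := by
      refine integral_congr_ae ?_
      filter_upwards [hae] with z hz
      rw [hgIn z hz]
    have key : |(P (W ∩ {z | (gIn z, (Φ.nthRecordOf i 0 z).impactVec) ∈ S} ∩ (X ∩ f ⁻¹' T))).toReal -
        ∫ z in W ∩ (X ∩ f ⁻¹' T), flux (gIn z) {ω | (gIn z, ω) ∈ S} ∂P| ≤ C * σ ^ p := by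
      rw [h1, h2, h3]
      exact hmain'
    exact key
  · -- `n ≥ 1`: the regime `{s_i = s_j} ∩ {n = 0}` is empty
    refine ⟨0, fun N _ Φ i S _ => ?_⟩
    intro G ε w q P W gIn flux E _
    have hempty : ((shortGap θ₀ 0).inter fun _ n _ _ _ => {_z | n = 0}) σ n N Φ i = ∅ := by
      ext z
      simp only [Regime.inter, mem_inter_iff, mem_setOf_eq, mem_empty_iff_false, iff_false, not_and]
      intro _
      omega
    simp only [hempty, Set.empty_inter, Set.inter_empty, measure_empty, ENNReal.toReal_zero,
      Measure.restrict_empty, integral_zero_measure, sub_zero, abs_zero]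
    positivity

end

end Summit.AtomisticToContinuum.HydrodynamicLimit.Theorems.OLC
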